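import Summits.KontsevichZagierPeriods.KontsevichZagierPeriods.Theses.WZCosetWall
import Literature.NumberTheory.Transcendental.KZSemialgebraicComplex
import Literature.NumberTheory.Transcendental.SemialgebraicLineDeriv

/-!
# `ResummedPrimitiveNL` (stmt-KontsevichZagierPeriods-6877, route WZCosetWall) — proof

The WZ engine as ONE packaged Newton–Leibniz move of the Kontsevich–Zagier calculus
(`KZ.newtonLeibnizRel`, rule (3) of `KZCalculus.lean`). Data: a band
`r.domain = {z | init z ∈ τ, a (init z) ≤ z last ≤ b (init z)}` over the base `τ = r'.domain` with
`ℚ`-semialgebraic `a ≤ b`; `ℚ`-semialgebraic `P`, `q` on the band with `|q| < 1` there; `P`, `q`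
continuous on each closed fibre and `t`-differentiable on each open fibre with derivatives `P'`,
`q'`; the integrand of `r` is `∂ₜ(P/(1−q)^{d+1}) = P'/(1−q)^{d+1} + (d+1)·P·q'/(1−q)^{d+2}` on the
open fibres and the integrand of `r'` is `P(·,b)/(1−q(·,b))^{d+1} − P(·,a)/(1−q(·,a))^{d+1}`. Claim:
`[r] − [r'] ∈ KZ.relations`.

Proof: it is literally one instance of `KZ.newtonLeibnizRel` with the RESUMMED primitive
`F := P/(1−q)^{d+1}` ("a family of integrations by parts with primitives `P·C(m+d,d)·q^m` resums to
one with the algebraic primitive `P/(1−q)^{d+1}`"). The three clauses to supply are: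
semialgebraicity of the quotient (`1 − q ≠ 0` on the band since `|q| < 1`; Bochnak–Coste–Roy
Prop. 2.2.6 toolkit `fun_sub`/`fun_pow`/`div`), fibrewise continuity of the quotient on the closed
fibre, and the quotient-rule identity `(P/(1−q)^{d+1})' = P'/(1−q)^{d+1} + (d+1)·P·q'/(1−q)^{d+2}` on
the open fibre (`HasDerivAt.fun_div`, `HasDerivAt.fun_pow`).
-/

noncomputable section

open Set
open Literature.NumberTheory.Transcendental Literature.ModelTheory.ExponentialFields

namespace Summit.KontsevichZagierPeriods.WZCosetWall

/-- **Semialgebraicity of the resummed primitive.** If `P` and `q` are `ℚ`-semialgebraic functions on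
`s ⊆ ℝᵐ` and `q ≠ 1` on `s`, then `P/(1 − q)^k` is `ℚ`-semialgebraic on `s` (difference, power and
quotient of semialgebraic functions, Bochnak–Coste–Roy Prop. 2.2.6).
[cite: BochnakCosteRoy1998, Prop. 2.2.6] -/
theorem isSemialgebraicFunOn_div_one_sub_pow {m : ℕ} {s : Set (Fin m → ℝ)}
    {P q : (Fin m → ℝ) → ℝ} (hP : IsSemialgebraicFunOn ℚ s P) (hq : IsSemialgebraicFunOn ℚ s q)
    (h1 : ∀ z ∈ s, q z ≠ 1) (k : ℕ) :
    IsSemialgebraicFunOn ℚ s fun z => P z / (1 - q z) ^ k := by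
  have hs : IsSemialgebraic ℚ s := IsSemialgebraicFunOn.isSemialgebraic_holds hP
  have hsub : IsSemialgebraicFunOn ℚ s fun z => 1 - q z :=
    ((isSemialgebraicFunOn_const_natCast hs 1).fun_sub hq).congr fun z _ => by
      simp only [Nat.cast_one]
  exact hP.div (hsub.fun_pow k) fun z hz => pow_ne_zero _ (sub_ne_zero.mpr (h1 z hz).symm)

/-- **Continuity of the resummed primitive on a closed fibre.** If `f`, `g : ℝ → ℝ` are continuous on
`S` and `g ≠ 1` on `S`, then `f/(1 − g)^k` is continuous on `S`. [folklore] -/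
theorem continuousOn_div_one_sub_pow {f g : ℝ → ℝ} {S : Set ℝ} (hf : ContinuousOn f S)
    (hg : ContinuousOn g S) (h1 : ∀ t ∈ S, g t ≠ 1) (k : ℕ) :
    ContinuousOn (fun t => f t / (1 - g t) ^ k) S :=
  hf.div ((continuousOn_const.sub hg).pow k) fun t ht =>
    pow_ne_zero _ (sub_ne_zero.mpr (h1 t ht).symm)

/-- **The quotient-rule identity behind the WZ resummation.** If `f` has derivative `f'` and `g` has
derivative `g'` at `t`, with `g t ≠ 1`, then `s ↦ f s / (1 − g s)^(d+1)` has derivative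
`f'/(1 − g t)^(d+1) + (d+1)·f t·g'/(1 − g t)^(d+2)` at `t`. [folklore] -/
theorem hasDerivAt_div_one_sub_pow {f g : ℝ → ℝ} {f' g' t : ℝ} (hf : HasDerivAt f f' t)
    (hg : HasDerivAt g g' t) (h1 : g t ≠ 1) (d : ℕ) :
    HasDerivAt (fun s => f s / (1 - g s) ^ (d + 1))
      (f' / (1 - g t) ^ (d + 1) + ((d : ℝ) + 1) * f t * g' / (1 - g t) ^ (d + 2)) t := by
  have hu : (1 - g t) ≠ 0 := sub_ne_zero.mpr h1.symm
  have hD : HasDerivAt (fun s => (1 - g s) ^ (d + 1))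
      (((d + 1 : ℕ) : ℝ) * (1 - g t) ^ (d + 1 - 1) * -g') t := (hg.const_sub 1).fun_pow (d + 1)
  refine (hf.fun_div hD (pow_ne_zero _ hu)).congr_deriv ?_
  simp only [Nat.cast_add, Nat.cast_one, Nat.add_sub_cancel]
  field_simp
  ring

/-- **`ResummedPrimitiveNL`** (route WZCosetWall, stmt-KontsevichZagierPeriods-6877): on a band
`{z | init z ∈ r'.domain, a (init z) ≤ z last ≤ b (init z)}` with `ℚ`-semialgebraic `a ≤ b`, `P`, `q`
(`|q| < 1` on the band), `P`, `q` continuous on closed fibres and `t`-differentiable on open fibres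
with derivatives `P'`, `q'`, the representation with integrand
`P'/(1−q)^{d+1} + (d+1)·P·q'/(1−q)^{d+2}` on the open fibres and the base representation with
integrand `P(·,b)/(1−q(·,b))^{d+1} − P(·,a)/(1−q(·,a))^{d+1}` differ by a relation of the
Kontsevich–Zagier calculus. Proof: one instance of `KZ.newtonLeibnizRel` with primitive
`F := P/(1−q)^{d+1}`, the clauses being `isSemialgebraicFunOn_div_one_sub_pow`,
`continuousOn_div_one_sub_pow` and `hasDerivAt_div_one_sub_pow`.
[cite: KontsevichZagier2001, §1.2 rule (3)] -/
theorem resummedPrimitiveNL_proof :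
    Summit.KontsevichZagierPeriods.KontsevichZagierPeriods.Theses.WZCosetWall.ResummedPrimitiveNL := by
  intro n d r r' a b P P' q q' ha hb hab hdom hP hq hq1 hcont hderiv hint hbase
  -- membership in the band, fibrewise
  have hmem : ∀ (x : Fin n → ℝ) (t : ℝ), x ∈ r'.domain → t ∈ Icc (a x) (b x) →
      (Fin.snoc x t : Fin (n + 1) → ℝ) ∈ r.domain := by
    intro x t hx ht
    rw [hdom]
    simpa only [mem_setOf_eq, Fin.init_snoc, Fin.snoc_last] using ⟨hx, ht.1, ht.2⟩
  -- `q ≠ 1` on the band, since `|q| < 1` there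
  have hq_ne : ∀ z ∈ r.domain, q z ≠ 1 := fun z hz => (abs_lt.mp (hq1 z hz)).2.ne
  refine KZ.newtonLeibnizRel_subset_relations
    ⟨n, r, r', a, b, fun z => P z / (1 - q z) ^ (d + 1),
      isSemialgebraicFunOn_div_one_sub_pow hP hq hq_ne (d + 1), ha, hb, hab, hdom, ?_, ?_, hbase, rfl⟩
  · -- continuity of the primitive on each closed fibre
    intro x hx
    exact continuousOn_div_one_sub_pow (hcont x hx).1 (hcont x hx).2
      (fun t ht => hq_ne _ (hmem x t hx ht)) (d + 1)
  · -- derivative of the primitive on each open fibre = the integrand of `r`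
    intro x hx t ht
    rw [hint x hx t ht]
    exact hasDerivAt_div_one_sub_pow (hderiv x hx t ht).1 (hderiv x hx t ht).2
      (hq_ne _ (hmem x t hx (Ioo_subset_Icc_self ht))) d

end Summit.KontsevichZagierPeriods.WZCosetWall

end
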